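import Summits.HodgeConjecture.HodgeConjecture.Theorems.NikulinTwinTransportRealMultiplicationCore
import Summits.HodgeConjecture.HodgeConjecture.Theorems.NikulinTwinTransportRealMultiplicationGForm
import Summits.HodgeConjecture.HodgeConjecture.Theorems.NikulinTwinTransportRealMultiplicationHodgeTypes

/-!
# Route NikulinTwinTransport · `RealMultiplicationGlue` (stmt-HodgeConjecture-13681) —
# the Witt correction of real multiplication from a rational `2`-self-similitude of `H²(S)`

Helper file (supports stmt-HodgeConjecture-13681). The linear-algebra heart of the glue
(Varesco 2023 Thm. 2.1 / Rem. 2.2; Huybrechts 2019 §1, "Witt cancellation over `ℚ`") is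
`exists_ratCorrection` of `NikulinTwinTransportRealMultiplicationCore`: real multiplication `e`
(rational, cup-self-adjoint, `e|_N = 0`, `e² = 2` on `T = N^⊥`) extends to a rational
`2`-similitude `Ξ₁ = e + ν̃` of `H²(S)` with `ν̃` a sum of products of divisors. There the input
"`(H²(S, ℚ), ∪)` admits a `2`-similitude" is read off the K3 MARKING (`Λ_ℚ(2) ≅ Λ_ℚ`,
`exists_twoSimilitude_k3FormRat`), which is the unproved named fact
`Huybrechts_K3_marking_exists`. This file proves the same statement with that input made an
explicit, marking-free HYPOTHESIS — a `ℂ`-linear `Ξ` of `H²(S(ℂ); ℂ)` preserving rational classes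
with `(Ξx ∪ Ξy) = 2 (x ∪ y)` — and with the marking replaced by the unconditional integral marking
of ANY smooth projective surface (`exists_integralMarking`, arbitrary unimodular Gram matrix `G`):

* `exists_wittCorrection` — given such `Ξ`, there are rational divisor classes `aᵢ, bᵢ ∈ N`
  such that for `ν̃ x = Σᵢ ((ηx)ᵀ G (ηaᵢ)) bᵢ` (i.e. `Σᵢ (x.aᵢ) bᵢ`) the endomorphism `e + ν̃`
  preserves rational classes and doubles cup products (`exists_similitude_extension` — the
  tree's proved Witt extension theorem — over `ℚ^ι` with the form `xᵀ G y`, then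
  `exists_eq_sum_rankOne`, complexified by `toBilin'_of_ratRestriction`);
* `cupProduct_neg_add_correction_eq'`, `isOfHodgeType_add_correction'` — the mirror
  `−e + ν̃` has the same cup products, and `±e + ν̃` preserve Hodge types as soon as `ν̃` kills
  the two lines `ℂσ, ℂσ̄` and its value classes `bᵢ` are of type `(1,1)` (intrinsic forms of
  `cupProduct_neg_add_correction_eq`, `isOfHodgeType_add_correction_of_oneOne`).

Everything is proved. Prover seat prover-pitem-stmt-HodgeConjecture-13681-2.
-/

noncomputable section

namespace Summit.HodgeConjecture.HodgeConjecture.Theorems.NikulinTwinTransport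

open scoped Manifold
open CategoryTheory Module MonoidalCategory
open Literature.AlgebraicGeometry Literature.AlgebraicGeometry.Motives
open Literature.AlgebraicGeometry.HodgeTheory Literature.AlgebraicGeometry.Surfaces
open Literature.AlgebraicTopology.SingularHomology

section Witt

variable {S : SchemeOver ℂ} {ι : Type} [Fintype ι] [DecidableEq ι]

/-- **The Witt correction of real multiplication, from a rational `2`-self-similitude.** Let `S`
be smooth projective of dimension `2` with an integral marking `η : H²(S(ℂ); ℂ) ≅ ℂ^ι`
(integral classes `↔ ℤ^ι`, `a ∪ b = ((ηa)ᵀ G (ηb)) p`, `p ≠ 0`, `G` symmetric unimodular), let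
`N = algebraicClasses S 1`, let `e` be rational, cup-self-adjoint, killing `N`, with `e² = 2` on
`N^⊥`, and SUPPOSE `H²(S(ℂ); ℂ)` carries a `ℂ`-linear `Ξ` preserving rational classes with
`(Ξx ∪ Ξy) = 2 (x ∪ y)`. Then there are rational classes `aᵢ, bᵢ ∈ N` such that, for
`ν̃ x = Σᵢ ((ηx)ᵀ G (ηaᵢ)) bᵢ`, the endomorphism `e + ν̃` preserves rational classes and satisfies
`((e+ν̃)x ∪ (e+ν̃)y) = 2 (x ∪ y)`. Proof: read `e` and `Ξ` in coordinates as `ℚ`-linear `ε`, `M`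
of `ℚ^ι` (`exists_ratEnd_of_integralMarking`); `M` is a `2`-similitude of the non-degenerate
symmetric form `xᵀ G y`, `ε` is self-adjoint, kills `N_ℚ` (the rational points of `N`) and has
`ε² = 2` on `N_ℚ^⊥` (`N` is spanned by its rational classes); Witt
(`exists_similitude_extension`) gives `g` with image in `N_ℚ`, kernel `⊇ N_ℚ^⊥` and `ε + g` a
`2`-similitude; expand `g = Σᵢ (·.aᵢ) bᵢ` (`exists_eq_sum_rankOne`) and complexify
(`toBilin'_of_ratRestriction`). [cite: Huybrechts2019, §1] [cite: Varesco2023, Thm. 2.1 and Rem. 2.2]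
[cite: Iversen1992, Ch. I §2 Thm. 2.4] -/
theorem exists_wittCorrection (hS : IsSmoothProjective 2 S)
    (η : complexBetti S (2 * 1) ≃ₗ[ℂ] (ι → ℂ)) (G : Matrix ι ι ℤ) (p : complexBetti S (2 * 2))
    (hp : p ≠ 0) (hGt : G.transpose = G) (hGdet : IsUnit G.det)
    (hηint : ∀ c : complexBetti S (2 * 1), IsIntegralClass c ↔ ∃ v : ι → ℤ, η c = fun i => (v i : ℂ))
    (hηcup : ∀ a b : complexBetti S (2 * 1), cupProduct (rfl : 2 * 1 + 2 * 1 = 2 * 2) a b =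
      Matrix.toBilin' (G.map (Int.cast : ℤ → ℂ)) (η a) (η b) • p)
    (Ξ : complexBetti S (2 * 1) →ₗ[ℂ] complexBetti S (2 * 1))
    (hΞrat : ∀ x, IsRationalClass x → IsRationalClass (Ξ x))
    (hΞ2 : ∀ x y : complexBetti S (2 * 1), cupProduct (rfl : 2 * 1 + 2 * 1 = 2 * 2) (Ξ x) (Ξ y) =
      (2 : ℂ) • cupProduct (rfl : 2 * 1 + 2 * 1 = 2 * 2) x y)
    (e : complexBetti S (2 * 1) →ₗ[ℂ] complexBetti S (2 * 1))
    (he_rat : ∀ x, IsRationalClass x → IsRationalClass (e x))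
    (he_adj : ∀ x y : complexBetti S (2 * 1),
      cupProduct (rfl : 2 * 1 + 2 * 1 = 2 * 2) (e x) y = cupProduct (rfl : 2 * 1 + 2 * 1 = 2 * 2) x (e y))
    (he_N : ∀ d ∈ algebraicClasses S 1, e d = 0)
    (he_T : ∀ x : complexBetti S (2 * 1),
      (∀ d ∈ algebraicClasses S 1, cupProduct (rfl : 2 * 1 + 2 * 1 = 2 * 2) x d = 0) →
        e (e x) = (2 : ℂ) • x) :
    ∃ (m : ℕ) (a b : Fin m → complexBetti S (2 * 1)),
      (∀ i, a i ∈ algebraicClasses S 1) ∧ (∀ i, b i ∈ algebraicClasses S 1) ∧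
      (∀ i, IsRationalClass (a i)) ∧ (∀ i, IsRationalClass (b i)) ∧
      ∀ ν : complexBetti S (2 * 1) →ₗ[ℂ] complexBetti S (2 * 1),
        (∀ x, ν x = ∑ i, Matrix.toBilin' (G.map (Int.cast : ℤ → ℂ)) (η x) (η (a i)) • b i) →
        (∀ x, IsRationalClass x → IsRationalClass ((e + ν) x)) ∧
        (∀ x y : complexBetti S (2 * 1),
          cupProduct (rfl : 2 * 1 + 2 * 1 = 2 * 2) ((e + ν) x) ((e + ν) y) =
            (2 : ℂ) • cupProduct (rfl : 2 * 1 + 2 * 1 = 2 * 2) x y) := by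
  classical
  set N := algebraicClasses S 1 with hNdef
  set Bc := Matrix.toBilin' (G.map (Int.cast : ℤ → ℂ)) with hBc
  set Bq := Matrix.toBilin' (G.map (Int.cast : ℤ → ℚ)) with hBq
  have hBqs : Bq.IsSymm := isSymm_toBilin'_map G hGt
  have hBcs : Bc.IsSymm := isSymm_toBilin'_map G hGt
  have hBqn : Bq.Nondegenerate := nondegenerate_toBilin'_map_rat G hGdet
  have hrat := isRationalClass_iff_of_integralMarking hS η hηint
  -- injectivity of `c ↦ c • p`
  have hsmul : ∀ {c c' : ℂ}, c • p = c' • p → c = c' := fun h => smul_left_injective ℂ hp h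
  -- `e` and `Ξ` read through the marking: `ℚ`-linear `ε`, `M`
  obtain ⟨ε, hε'⟩ := exists_ratEnd_of_integralMarking hS η hηint e he_rat
  have hεx : ∀ u : ι → ℚ, e (η.symm fun j => (u j : ℂ)) = η.symm fun j => (ε u j : ℂ) := fun u => by
    rw [← hε' u, LinearEquiv.symm_apply_apply]
  obtain ⟨M, hM'⟩ := exists_ratEnd_of_integralMarking hS η hηint Ξ hΞrat
  have hM : ∀ u v, Bq (M u) (M v) = 2 * Bq u v := by
    intro u v
    apply Rat.cast_injective (α := ℂ)
    rw [Rat.cast_mul, Rat.cast_ofNat, hBq, ← toBilin'_map_ratCast, ← toBilin'_map_ratCast, ← hM' u,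
      ← hM' v]
    have h := hΞ2 (η.symm fun j => (u j : ℂ)) (η.symm fun j => (v j : ℂ))
    rw [hηcup, hηcup, LinearEquiv.apply_symm_apply, LinearEquiv.apply_symm_apply, smul_smul] at h
    exact hsmul h
  -- the rational points of `N`
  let NQ : Submodule ℚ (ι → ℚ) :=
    { carrier := {u | η.symm (fun j => (u j : ℂ)) ∈ N}
      add_mem' := fun {u v} hu hv => by
        simp only [Set.mem_setOf_eq, ratCastVec_add, map_add]
        exact N.add_mem hu hv
      zero_mem' := by
        simp only [Set.mem_setOf_eq, ratCastVec_zero, map_zero]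
        exact N.zero_mem
      smul_mem' := fun q u hu => by
        simp only [Set.mem_setOf_eq, ratCastVec_smul, map_smul]
        exact N.smul_mem _ hu }
  have memNQ : ∀ u, u ∈ NQ ↔ η.symm (fun j => (u j : ℂ)) ∈ N := fun u => Iff.rfl
  -- (adj) `ε` is self-adjoint for the rational form
  have hadj : ∀ u v, Bq (ε u) v = Bq u (ε v) := by
    intro u v
    apply Rat.cast_injective (α := ℂ)
    rw [hBq, ← toBilin'_map_ratCast, ← toBilin'_map_ratCast, ← hε' u, ← hε' v]
    have h := he_adj (η.symm fun j => (u j : ℂ)) (η.symm fun j => (v j : ℂ))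
    rw [hηcup, hηcup, LinearEquiv.apply_symm_apply, LinearEquiv.apply_symm_apply] at h
    exact hsmul h
  -- (N) `ε` kills `N_ℚ`
  have hN : ∀ u ∈ NQ, ε u = 0 := by
    intro u hu
    apply ratCastVec_injective
    rw [← hε' u, he_N _ ((memNQ u).1 hu), map_zero, ratCastVec_zero]
  -- `N` is spanned by its rational classes, so `N_ℚ^⊥ ⊗ ℂ ⊆ N^⊥`
  have hspan := span_isRationalClass_eq_top_of_isSmoothProjective_holds.supportedClasses_eq_span
    hS (2 * 1) 1
  have horth : ∀ u ∈ Bq.orthogonal NQ, ∀ d ∈ N, Bc (fun j => (u j : ℂ)) (η d) = 0 := by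
    intro u hu d hd
    rw [LinearMap.BilinForm.mem_orthogonal_iff] at hu
    have hd' : d ∈ Submodule.span ℂ {c : complexBetti S (2 * 1) |
        IsRationalClass c ∧ c ∈ supportedClasses S (2 * 1) 1} := by
      rw [← hspan]; exact hd
    clear hd
    induction hd' using Submodule.span_induction with
    | mem d hd =>
      obtain ⟨w, hw⟩ := (hrat d).1 hd.1
      have hwN : w ∈ NQ := by
        rw [memNQ, ← hw, LinearEquiv.symm_apply_apply]
        exact hd.2
      rw [hw, hBc, toBilin'_map_ratCast, ← hBq, hBqs.eq, hu w hwN, Rat.cast_zero]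
    | zero => rw [map_zero, map_zero]
    | add c c' _ _ hc hc' => rw [map_add, map_add, hc, hc', add_zero]
    | smul t c _ hc => rw [map_smul, map_smul, smul_eq_mul, hc, mul_zero]
  -- (T) `ε² = 2` on `N_ℚ^⊥`
  have hT : ∀ u ∈ Bq.orthogonal NQ, ε (ε u) = (2 : ℚ) • u := by
    intro u hu
    have hx : ∀ d ∈ algebraicClasses S 1,
        cupProduct (rfl : 2 * 1 + 2 * 1 = 2 * 2) (η.symm fun j => (u j : ℂ)) d = 0 := fun d hd => by
      rw [hηcup, LinearEquiv.apply_symm_apply, horth u hu d hd, zero_smul]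
    have h2 := he_T _ hx
    rw [hεx, hεx, ← LinearEquiv.map_smul, ← Rat.cast_ofNat, ← ratCastVec_smul] at h2
    exact ratCastVec_injective (η.symm.injective h2)
  -- Witt: extend to a `2`-similitude, then expand the correction in rank-one maps
  obtain ⟨-, g, hgN, hgT, hsim⟩ := exists_similitude_extension hBqs hBqn (two_ne_zero (α := ℚ))
    M hM NQ ε hadj hN hT
  obtain ⟨m, a', b', ha', hb', hg⟩ := exists_eq_sum_rankOne hBqs hBqn NQ g hgN hgT
  -- the correction classes
  refine ⟨m, fun i => η.symm fun j => (a' i j : ℂ), fun i => η.symm fun j => (b' i j : ℂ),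
    fun i => (memNQ _).1 (ha' i), fun i => (memNQ _).1 (hb' i),
    fun i => (hrat _).2 ⟨a' i, η.apply_symm_apply _⟩,
    fun i => (hrat _).2 ⟨b' i, η.apply_symm_apply _⟩, fun ν hν => ?_⟩
  -- `η (e + ν) η⁻¹` restricts to `ξ = ε + g` on `ℚ^ι`
  have hΛ : ∀ u : ι → ℚ, η ((e + ν) (η.symm fun j => (u j : ℂ))) = fun j => ((ε + g) u j : ℂ) := by
    intro u
    rw [LinearMap.add_apply, map_add, hε' u, hν, map_sum, LinearMap.add_apply, ratCastVec_add, hg u,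
      ratCastVec_sum]
    congr 1
    refine Finset.sum_congr rfl fun i _ => ?_
    rw [map_smul, LinearEquiv.apply_symm_apply, LinearEquiv.apply_symm_apply,
      LinearEquiv.apply_symm_apply, hBc, toBilin'_map_ratCast, ratCastVec_smul]
  refine ⟨fun x hx => ?_, fun x y => ?_⟩
  · -- rationality
    obtain ⟨u, hu⟩ := (hrat x).1 hx
    have hx' : x = η.symm fun j => (u j : ℂ) := by rw [← hu, LinearEquiv.symm_apply_apply]
    refine (hrat _).2 ⟨(ε + g) u, ?_⟩
    rw [hx', hΛ u]
  · -- the `2`-similitude property, complexified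
    have hΛ' : ∀ u : ι → ℚ, (η.toLinearMap ∘ₗ (e + ν) ∘ₗ η.symm.toLinearMap) (fun j => (u j : ℂ)) =
        fun j => ((ε + g) u j : ℂ) := fun u => by
      simpa only [LinearMap.coe_comp, LinearEquiv.coe_coe, Function.comp_apply] using hΛ u
    have h2 := toBilin'_of_ratRestriction G _ (ε + g) hΛ' 2 hsim (η x) (η y)
    simp only [LinearMap.coe_comp, LinearEquiv.coe_coe, Function.comp_apply,
      LinearEquiv.symm_apply_apply, Rat.cast_ofNat] at h2
    rw [hηcup, hηcup, h2, smul_smul]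

end Witt

/-! ### The mirror similitude and type preservation, intrinsic forms -/

section Mirror

variable {S : SchemeOver ℂ}

/-- **The mirror similitude, intrinsic form.** For a cup-self-adjoint `e` and a correction
`ν̃ x = Σᵢ fᵢ(x) bᵢ` whose value classes `bᵢ` are killed by `e`, the mirror `−e + ν̃` has the same
cup products as `e + ν̃`: the cross terms `(ex ∪ ν̃y) = Σᵢ fᵢ(y) (x ∪ e bᵢ) = 0` and
`(ν̃x ∪ ey) = 0` vanish. [folklore] -/
theorem cupProduct_neg_add_correction_eq'
    (e ν : complexBetti S (2 * 1) →ₗ[ℂ] complexBetti S (2 * 1))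
    (he_adj : ∀ x y : complexBetti S (2 * 1),
      cupProduct (rfl : 2 * 1 + 2 * 1 = 2 * 2) (e x) y = cupProduct (rfl : 2 * 1 + 2 * 1 = 2 * 2) x (e y))
    {m : ℕ} (f : complexBetti S (2 * 1) → Fin m → ℂ) (b : Fin m → complexBetti S (2 * 1))
    (hν : ∀ x, ν x = ∑ i, f x i • b i) (heb : ∀ i, e (b i) = 0)
    (x y : complexBetti S (2 * 1)) :
    cupProduct (rfl : 2 * 1 + 2 * 1 = 2 * 2) ((-e + ν) x) ((-e + ν) y) =
      cupProduct (rfl : 2 * 1 + 2 * 1 = 2 * 2) ((e + ν) x) ((e + ν) y) := by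
  have h1 : cupProduct (rfl : 2 * 1 + 2 * 1 = 2 * 2) (e x) (ν y) = 0 := by
    rw [hν y, map_sum]
    refine Finset.sum_eq_zero fun i _ => ?_
    rw [LinearMap.map_smul, he_adj, heb i, map_zero, smul_zero]
  have h2 : cupProduct (rfl : 2 * 1 + 2 * 1 = 2 * 2) (ν x) (e y) = 0 := by
    rw [hν x, map_sum, LinearMap.sum_apply]
    refine Finset.sum_eq_zero fun i _ => ?_
    rw [LinearMap.map_smul₂, ← he_adj, heb i, map_zero, LinearMap.zero_apply, smul_zero]
  simp only [LinearMap.add_apply, LinearMap.neg_apply, map_add, map_neg, LinearMap.add_apply,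
    LinearMap.neg_apply, h1, h2, neg_zero, add_zero, neg_neg]

/-- **`Ξ = e + ν̃` preserves every Hodge type, intrinsic form.** On a smooth projective surface
whose `(2,0)`-classes form the line `ℂσ` and whose `(0,2)`-classes form the line `ℂσ'`: if `e`
preserves Hodge types, `ν̃` kills `σ` and `σ'`, and `ν̃ x = Σᵢ fᵢ(x) bᵢ` with all `bᵢ` of type
`(1,1)`, then `e + ν̃` preserves every Hodge type (`IsOfHodgeType.add/.sum/.smul`; the bidegrees
`i + j ≠ 2` carry only `0`). [cite: VoisinHodgeI2002, §7.1.1 and Cor. 6.12]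
[cite: Huybrechts2016K3, Ch. 6 Prop. 1.2] -/
theorem isOfHodgeType_add_correction' (hS : IsSmoothProjective 2 S) (A : HodgeModel 2 S)
    {σ σ' : complexBetti S (2 * 1)}
    (h1 : ∀ c : complexBetti S (2 * 1), IsOfHodgeType 2 S (2 * 1) 2 0 c ↔ ∃ t : ℂ, c = t • σ)
    (h2 : ∀ c : complexBetti S (2 * 1), IsOfHodgeType 2 S (2 * 1) 0 2 c ↔ ∃ t : ℂ, c = t • σ')
    (e ν : complexBetti S (2 * 1) →ₗ[ℂ] complexBetti S (2 * 1))
    (he_type : ∀ (i j : ℕ) x, IsOfHodgeType 2 S (2 * 1) i j x → IsOfHodgeType 2 S (2 * 1) i j (e x))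
    {m : ℕ} (f : complexBetti S (2 * 1) → Fin m → ℂ) (b : Fin m → complexBetti S (2 * 1))
    (hν : ∀ x, ν x = ∑ i, f x i • b i) (hν0 : ν σ = 0) (hν0' : ν σ' = 0)
    (hb : ∀ i, IsOfHodgeType 2 S (2 * 1) 1 1 (b i)) :
    ∀ (i j : ℕ) (y : complexBetti S (2 * 1)),
      IsOfHodgeType 2 S (2 * 1) i j y → IsOfHodgeType 2 S (2 * 1) i j ((e + ν) y) := by
  intro i j y hy
  by_cases hij : i + j = 2 * 1
  · obtain ⟨rfl, rfl⟩ | ⟨rfl, rfl⟩ | ⟨rfl, rfl⟩ :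
        (i = 2 ∧ j = 0) ∨ (i = 0 ∧ j = 2) ∨ (i = 1 ∧ j = 1) := by omega
    · obtain ⟨t, ht⟩ := (h1 y).1 hy
      rw [LinearMap.add_apply, show ν y = 0 by rw [ht, map_smul, hν0, smul_zero], add_zero]
      exact he_type 2 0 y hy
    · obtain ⟨t, ht⟩ := (h2 y).1 hy
      rw [LinearMap.add_apply, show ν y = 0 by rw [ht, map_smul, hν0', smul_zero], add_zero]
      exact he_type 0 2 y hy
    · rw [LinearMap.add_apply, hν]
      exact (he_type 1 1 y hy).add hS
        (IsOfHodgeType.sum hS A Finset.univ _ fun k _ => (hb k).smul _)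
  · obtain rfl := isOfHodgeType_eq_zero_of_add_ne hy hij
    rw [map_zero]
    exact IsOfHodgeType.zero A _ _ _

end Mirror

end Summit.HodgeConjecture.HodgeConjecture.Theorems.NikulinTwinTransport

end
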